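import Summits.QuantumFields.YangMills.Theorems.UnitScaleTiltProp7CovLinAvgStructureStep
import HarnessLib

/-!
# Route `UnitScaleTilt`, crux K1 «MinimiserStabilityRegPr» (stmt-QuantumFields-19200), route-R [RP] curved, the curved N6 row (R-C), transport geometry, Step A letters —
# THE COVARIANT STRAIGHT SUM TERM BY TERM, AND «`LINE` OF A TRANSPORTED FAMILY IS A TRANSPORTED FAMILY»:
# `Z_V([x → m steps e_μ]) = Σ_{t<m} Ad_{V([x → t steps])} Z(x+te_μ, μ)`, and if `Z(b) = Σ_ω Ad_{τ(b,ω)} Y(β(b,ω))` then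
# `LINE_VZ(c) = |I|⁻¹Σ_iΣ_{t<L}Σ_ω Ad_{V(Γ_i)·V([x_i → t steps])·τ(b_{i,t},ω)} Y(β(b_{i,t},ω))`

Cell `ym3-torus`, width seat `ym-ust-20520-w2` (g3).  Generic letters for Step A of the memo `RC-TRANSPORT-GEOMETRY-w2g3.md` (19200 evidence): iterating them along the
background tower writes the pure `LINE`-iterate `S_k` (`S_{j+1} = LINE_{Ū₀^{(j)}}S_j`) as ONE transported family over the one-stroke index set, ready for the termwise
transport comparison with the engine's `A^{U₀}` (Steps B–C) and the `ℓ²` count (Step D, `…Prop7BlockLineCount`).  THEOREMS ONLY (0 `def`, 0 `sorry`);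
`--supports stmt-QuantumFields-19200`, count-neutral.  YM₃ on T³ is a ladder rung (R3), not the Clay problem; nothing here claims the curved N6, S2, P, the crux or the gap.

WHAT IS PROVED (ns `…Theorems.Prop7LineOfTransportedFamily`; `LINE_V` written out as in ✓ p606243 ∕ ✓ p606827).
* §1 `holAt_walk_replicate_succ` (`V([x → t+1 steps]) = V(x,μ)·V([x+e_μ → t steps])`), ★ `covWalkSum_walk_replicate_true` (the straight covariant sum term by term).
* §2 ★★ `line_of_transported_family` — the title identity, for any finite index type `Ω`, transports `τ : PBond P j → Ω → SU(N)` and sources `β : PBond P j → Ω → ι`,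
  `Y : ι → M_N(ℂ)`; `line_of_transported_family_fin` — the same with `t : Fin L` (so the new index type `Idx P × Fin L × Ω` is a `Fintype` product, for the induction).
HONEST SCOPE.  Algebra (linearity and multiplicativity of transports); no estimate.

References: T. Bałaban, CMP 98 (1985) 17–51 [Balaban1985Averaging] ((58) p.27, (125) p.36); CMP 95 (1984) 17–40 [Balaban1984PropagatorsI] ((1.18) p.20).
-/

noncomputable section

open scoped BigOperators Matrix.Norms.L2Operator

namespace Summit.QuantumFields.YangMills.Theorems.Prop7LineOfTransportedFamily

open Literature.MathematicalPhysics.QuantumFieldTheory.Balaban1983to89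
open Finset T4Continuum BlockAveraging AveragingRT ExpMeanLog BlockAveragingEMLLinearised BlockAveragingEMLLinearisedBackground

variable {P : Params} {n : Type*} [Fintype n] [DecidableEq n] [Nonempty n] {j : ℕ}

/-! ## §1 The covariant straight sum, term by term -/

omit [Fintype n] [DecidableEq n] [Nonempty n] in
/-- `V([x → t+1 steps e_μ]) = V(x, μ)·V([x + e_μ → t steps e_μ])`. [folklore] -/
theorem holAt_walk_replicate_succ {G : Type*} [GaugeGroup G] (V : GaugeField P j G) (x : Site P j) (μ : Fin P.d) (t : ℕ) :
    holAt V (walk x (List.replicate (t + 1) (μ, true))) = V ⟨x, μ⟩ * holAt V (walk (x.shift μ) (List.replicate t (μ, true))) := by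
  rw [List.replicate_succ, walk, holAt_cons]
  simp

/-- ★ **THE COVARIANT STRAIGHT SUM TERM BY TERM**: `Z_V([x → m steps e_μ]) = Σ_{t<m} V([x→t])·Z(x+te_μ, μ)·V([x→t])*` — each step term transported back to `x` by the
holonomy of the preceding steps. [cite: Balaban1985Averaging, (58) p.27] -/
theorem covWalkSum_walk_replicate_true (V : GaugeField P j (Matrix.specialUnitaryGroup n ℂ)) (Z : PBond P j → Matrix n n ℂ) (μ : Fin P.d) :
    ∀ (m : ℕ) (x : Site P j), covWalkSum V Z (walk x (List.replicate m (μ, true)))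
      = ∑ t ∈ Finset.range m,
          ((holAt V (walk x (List.replicate t (μ, true))) : Matrix.specialUnitaryGroup n ℂ) : Matrix n n ℂ) * Z ⟨(fun z : Site P j => z.shift μ)^[t] x, μ⟩
            * star ((holAt V (walk x (List.replicate t (μ, true))) : Matrix.specialUnitaryGroup n ℂ) : Matrix n n ℂ)
  | 0, x => by simp [walk]
  | m + 1, x => by
    rw [List.replicate_succ, walk, covWalkSum_cons, covWalkSum_walk_replicate_true V Z μ m (x.shift μ), Finset.sum_range_succ']
    -- the first term: `t = 0`, trivial transport
    have h0 : ((holAt V (walk x (List.replicate 0 (μ, true))) : Matrix.specialUnitaryGroup n ℂ) : Matrix n n ℂ) = 1 := by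
      simp [walk, holAt_nil]
    simp only [Function.iterate_succ_apply, Function.iterate_zero_apply, h0, one_mul, star_one, mul_one, holAt_walk_replicate_succ, Submonoid.coe_mul, star_mul]
    -- step term and step factor of a forward step
    have hstep : covStep V Z ⟨⟨x, μ⟩, true⟩ = Z ⟨x, μ⟩ := by simp [covStep]
    have hfac : stepFactor V ⟨⟨x, μ⟩, true⟩ = ((V ⟨x, μ⟩ : Matrix.specialUnitaryGroup n ℂ) : Matrix n n ℂ) := by simp [stepFactor]
    rw [hstep, hfac, Finset.mul_sum, Finset.sum_mul, add_comm]
    congr 1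
    refine Finset.sum_congr rfl fun t _ => ?_
    noncomm_ring

/-! ## §2 ★★ `LINE` of a transported family -/

/-- ★★ **`LINE` OF A TRANSPORTED FAMILY IS A TRANSPORTED FAMILY.**  If the level-`j` field is `Z(b) = Σ_{ω} τ(b,ω)·Y(β(b,ω))·τ(b,ω)*` (finitely many transported sources),
then, with `Γ_i = stairWord σ_i (off r_i)` from `emb c₋`, `x_i` its end, `h_{i,t} = V([x_i → t steps e_μ])`, `b_{i,t} = (x_i + te_μ, μ)`:
`LINE_VZ(c) = |I|⁻¹Σ_iΣ_{t<L}Σ_ω (V(Γ_i)h_{i,t}τ(b_{i,t},ω))·Y(β(b_{i,t},ω))·(V(Γ_i)h_{i,t}τ(b_{i,t},ω))*`. [cite: Balaban1985Averaging, (125) p.36] -/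
theorem line_of_transported_family {Ω ι : Type*} [Fintype Ω] (V : GaugeField P j (Matrix.specialUnitaryGroup n ℂ))
    (τ : PBond P j → Ω → Matrix.specialUnitaryGroup n ℂ) (β : PBond P j → Ω → ι) (Y : ι → Matrix n n ℂ) (Z : PBond P j → Matrix n n ℂ)
    (hZ : ∀ b, Z b = ∑ ω, ((τ b ω : Matrix.specialUnitaryGroup n ℂ) : Matrix n n ℂ) * Y (β b ω) * star ((τ b ω : Matrix.specialUnitaryGroup n ℂ) : Matrix n n ℂ))
    (c : PBond P (j + 1)) :
    ((Fintype.card (Idx P) : ℂ))⁻¹ • ∑ i : Idx P,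
        ((holAt V (walk (emb c.src) (stairWord i.2.1 (off i.1))) : Matrix.specialUnitaryGroup n ℂ) : Matrix n n ℂ) *
          covWalkSum V Z (walk (walkEnd (emb c.src) (stairWord i.2.1 (off i.1))) (List.replicate P.L (c.dir, true))) *
        star ((holAt V (walk (emb c.src) (stairWord i.2.1 (off i.1))) : Matrix.specialUnitaryGroup n ℂ) : Matrix n n ℂ)
      = ((Fintype.card (Idx P) : ℂ))⁻¹ • ∑ i : Idx P, ∑ t ∈ Finset.range P.L, ∑ ω,
          ((holAt V (walk (emb c.src) (stairWord i.2.1 (off i.1)))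
              * holAt V (walk (walkEnd (emb c.src) (stairWord i.2.1 (off i.1))) (List.replicate t (c.dir, true)))
              * τ ⟨(fun z : Site P j => z.shift c.dir)^[t] (walkEnd (emb c.src) (stairWord i.2.1 (off i.1))), c.dir⟩ ω : Matrix.specialUnitaryGroup n ℂ) : Matrix n n ℂ)
          * Y (β ⟨(fun z : Site P j => z.shift c.dir)^[t] (walkEnd (emb c.src) (stairWord i.2.1 (off i.1))), c.dir⟩ ω)
          * star ((holAt V (walk (emb c.src) (stairWord i.2.1 (off i.1)))
              * holAt V (walk (walkEnd (emb c.src) (stairWord i.2.1 (off i.1))) (List.replicate t (c.dir, true)))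
              * τ ⟨(fun z : Site P j => z.shift c.dir)^[t] (walkEnd (emb c.src) (stairWord i.2.1 (off i.1))), c.dir⟩ ω : Matrix.specialUnitaryGroup n ℂ) :
                Matrix n n ℂ) := by
  congr 1
  refine Finset.sum_congr rfl fun i _ => ?_
  rw [covWalkSum_walk_replicate_true, Finset.mul_sum, Finset.sum_mul]
  refine Finset.sum_congr rfl fun t _ => ?_
  rw [hZ, Finset.mul_sum, Finset.sum_mul, Finset.mul_sum, Finset.sum_mul]
  refine Finset.sum_congr rfl fun ω _ => ?_
  simp only [Submonoid.coe_mul, star_mul]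
  noncomm_ring

/-- The same with the step index of `Fin L` type (so that the refined index set `Idx P × Fin L × Ω` is a `Fintype` product, ready for the next level).
[cite: Balaban1985Averaging, (125) p.36] -/
theorem line_of_transported_family_fin {Ω ι : Type*} [Fintype Ω] (V : GaugeField P j (Matrix.specialUnitaryGroup n ℂ))
    (τ : PBond P j → Ω → Matrix.specialUnitaryGroup n ℂ) (β : PBond P j → Ω → ι) (Y : ι → Matrix n n ℂ) (Z : PBond P j → Matrix n n ℂ)
    (hZ : ∀ b, Z b = ∑ ω, ((τ b ω : Matrix.specialUnitaryGroup n ℂ) : Matrix n n ℂ) * Y (β b ω) * star ((τ b ω : Matrix.specialUnitaryGroup n ℂ) : Matrix n n ℂ))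
    (c : PBond P (j + 1)) :
    ((Fintype.card (Idx P) : ℂ))⁻¹ • ∑ i : Idx P,
        ((holAt V (walk (emb c.src) (stairWord i.2.1 (off i.1))) : Matrix.specialUnitaryGroup n ℂ) : Matrix n n ℂ) *
          covWalkSum V Z (walk (walkEnd (emb c.src) (stairWord i.2.1 (off i.1))) (List.replicate P.L (c.dir, true))) *
        star ((holAt V (walk (emb c.src) (stairWord i.2.1 (off i.1))) : Matrix.specialUnitaryGroup n ℂ) : Matrix n n ℂ)
      = ((Fintype.card (Idx P) : ℂ))⁻¹ • ∑ p : Idx P × Fin P.L × Ω,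
          ((holAt V (walk (emb c.src) (stairWord p.1.2.1 (off p.1.1)))
              * holAt V (walk (walkEnd (emb c.src) (stairWord p.1.2.1 (off p.1.1))) (List.replicate (p.2.1 : ℕ) (c.dir, true)))
              * τ ⟨(fun z : Site P j => z.shift c.dir)^[(p.2.1 : ℕ)] (walkEnd (emb c.src) (stairWord p.1.2.1 (off p.1.1))), c.dir⟩ p.2.2 :
                Matrix.specialUnitaryGroup n ℂ) : Matrix n n ℂ)
          * Y (β ⟨(fun z : Site P j => z.shift c.dir)^[(p.2.1 : ℕ)] (walkEnd (emb c.src) (stairWord p.1.2.1 (off p.1.1))), c.dir⟩ p.2.2)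
          * star ((holAt V (walk (emb c.src) (stairWord p.1.2.1 (off p.1.1)))
              * holAt V (walk (walkEnd (emb c.src) (stairWord p.1.2.1 (off p.1.1))) (List.replicate (p.2.1 : ℕ) (c.dir, true)))
              * τ ⟨(fun z : Site P j => z.shift c.dir)^[(p.2.1 : ℕ)] (walkEnd (emb c.src) (stairWord p.1.2.1 (off p.1.1))), c.dir⟩ p.2.2 :
                Matrix.specialUnitaryGroup n ℂ) : Matrix n n ℂ) := by
  rw [line_of_transported_family V τ β Y Z hZ c]
  congr 1
  simp only [← Fin.sum_univ_eq_sum_range]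
  simp only [Fintype.sum_prod_type]

end Summit.QuantumFields.YangMills.Theorems.Prop7LineOfTransportedFamily

end
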